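import Mathlib

/-!
# Crux `WordLengthQP` (stmt-ValiantsHypothesis-6623), line `Sketch` (eps-order-ladder) —
stub `stub_rankOneCut`

Rung 1 of the line's ε-order ladder in tangent form is
`f = Σ_{t<L} (A₁⋯A_{t−1} · B_t · A_{t+1}⋯A_L)₀₀` over ONE exact skeleton `A₁ … A_L` of `2 × 2`
matrices with `(A₁⋯A_L)₀₀ = 0` (in Lean the `t`-th term is
`((As.take t).prod * Bs.getD t 0 * (As.drop (t+1)).prod) 0 0`).  This file proves the
ONE-WINDOW CUT: if a skeleton letter `A_s = α βᵀ` is an outer product (`Matrix.vecMulVec α β`),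
then `(∏ A)₀₀ = L_s · R_s` with `L_s = (A_{<s} α)₀` and `R_s = (βᵀ A_{>s})₀`; every tangent term
with `t > s` is a multiple of `L_s` and every term with `t < s` is a multiple of `R_s`, so over a
domain `(∏ A)₀₀ = 0` kills all the terms on one side of `s`.
-/

-- `Summit.ValiantsHypothesis.ValiantsHypothesis.…` is the tree's mandated single-conjunct layout
-- (Sub = Summit), so the duplicated namespace component is intended.
set_option linter.dupNamespace false

noncomputable section

namespace Summit.ValiantsHypothesis.ValiantsHypothesis.Cruxes.WordLengthQP.EpsOrderLadder

/-- Entries of a product through a rank-one factor: `(P · α βᵀ · Q) i j = (P α)ᵢ · (βᵀ Q)ⱼ`.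
[folklore] -/
theorem rankOneCut_mul_vecMulVec_mul_apply {R : Type} [CommRing R] {m : Type} [Fintype m]
    (P Q : Matrix m m R) (α β : m → R) (i j : m) :
    (P * (Matrix.vecMulVec α β * Q)) i j = (P.mulVec α) i * (Matrix.vecMul β Q) j := by
  rw [Matrix.vecMulVec_mul, Matrix.mul_vecMulVec, Matrix.vecMulVec_apply]

/-- The one-window cut for a skeleton already split as `l₁ ++ α βᵀ :: l₂` around its rank-one
letter: over a domain, `(∏ A)₀₀ = (l₁.prod α)₀ · (βᵀ l₂.prod)₀ = 0` forces one factor to vanish,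
and that factor divides every tangent term on the corresponding side of the letter. [folklore] -/
theorem rankOneCut_split {R : Type} [CommRing R] [IsDomain R]
    (l₁ l₂ Bs : List (Matrix (Fin 2) (Fin 2) R)) (α β : Fin 2 → R)
    (h0 : (l₁ ++ Matrix.vecMulVec α β :: l₂).prod 0 0 = 0) :
    (∀ t, l₁.length < t →
        (((l₁ ++ Matrix.vecMulVec α β :: l₂).take t).prod * Bs.getD t 0 *
          ((l₁ ++ Matrix.vecMulVec α β :: l₂).drop (t + 1)).prod) 0 0 = 0) ∨
    (∀ t, t < l₁.length →
        (((l₁ ++ Matrix.vecMulVec α β :: l₂).take t).prod * Bs.getD t 0 *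
          ((l₁ ++ Matrix.vecMulVec α β :: l₂).drop (t + 1)).prod) 0 0 = 0) := by
  rw [List.prod_append, List.prod_cons, rankOneCut_mul_vecMulVec_mul_apply] at h0
  rcases mul_eq_zero.1 h0 with hL | hR
  · -- `L_s = 0`: every term with `t > s` starts with `l₁.prod * α βᵀ`, whose row `0` vanishes.
    refine Or.inl fun t ht => ?_
    obtain ⟨m, rfl⟩ := Nat.exists_eq_add_of_lt ht
    have htake : (l₁ ++ Matrix.vecMulVec α β :: l₂).take (l₁.length + m + 1) =
        l₁ ++ Matrix.vecMulVec α β :: l₂.take m := by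
      rw [List.take_append, List.take_of_length_le (by omega),
        show l₁.length + m + 1 - l₁.length = m + 1 by omega, List.take_succ_cons]
    rw [htake, List.prod_append, List.prod_cons]
    simp only [Matrix.mul_assoc]
    rw [rankOneCut_mul_vecMulVec_mul_apply, hL, zero_mul]
  · -- `R_s = 0`: every term with `t < s` ends with `α βᵀ * l₂.prod`, whose column `0` vanishes.
    refine Or.inr fun t ht => ?_
    rw [List.drop_append_of_le_length ht, List.prod_append, List.prod_cons,
      ← Matrix.mul_assoc _ (l₁.drop (t + 1)).prod, rankOneCut_mul_vecMulVec_mul_apply, hR,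
      mul_zero]

/-- **stub_rankOneCut** (one-window cut): if the skeleton letter `A_s = α βᵀ` is an outer
product, then `(∏ A)₀₀ = L_s · R_s` with `L_s = (A_{<s} α)₀`, `R_s = (βᵀ A_{>s})₀`, every tangent
term `(A_{<t} B_t A_{>t})₀₀` with `t > s` is a multiple of `L_s` and every one with `t < s` a
multiple of `R_s`; so over a domain `(∏ A)₀₀ = 0` kills ALL terms on one side of `s`. [folklore] -/
theorem stub_rankOneCut {R : Type} [CommRing R] [IsDomain R]
    (As Bs : List (Matrix (Fin 2) (Fin 2) R)) (s : ℕ) (hs : s < As.length)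
    (α β : Fin 2 → R) (hAs : As[s] = Matrix.vecMulVec α β)
    (h0 : As.prod 0 0 = 0) :
    (∀ t, s < t → t < As.length →
        ((As.take t).prod * Bs.getD t 0 * (As.drop (t + 1)).prod) 0 0 = 0) ∨
    (∀ t, t < s →
        ((As.take t).prod * Bs.getD t 0 * (As.drop (t + 1)).prod) 0 0 = 0) := by
  obtain ⟨l₁, l₂, rfl, rfl⟩ :
      ∃ l₁ l₂, As = l₁ ++ Matrix.vecMulVec α β :: l₂ ∧ l₁.length = s :=
    ⟨As.take s, As.drop (s + 1),
      by rw [← hAs, ← List.drop_eq_getElem_cons hs, List.take_append_drop],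
      List.length_take_of_le hs.le⟩
  exact (rankOneCut_split l₁ l₂ Bs α β h0).imp (fun h t ht _ => h t ht) id

end Summit.ValiantsHypothesis.ValiantsHypothesis.Cruxes.WordLengthQP.EpsOrderLadder

end
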